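/-
Copyright: the b2b-balaban T⁴-continuum CRUX team, row NE7b leaf lineage `t4-ne7b-formalise-leaf-03` (gen 147). Project licence.
-/
import Mathlib.Analysis.Calculus.ContDiff.Comp
import Mathlib.Analysis.Calculus.Deriv.Slope
import Mathlib.Analysis.Calculus.Deriv.Comp
import Mathlib.Analysis.Calculus.Deriv.Add
import Mathlib.Analysis.Calculus.Deriv.Mul
import Mathlib.Analysis.Convex.Function
import Mathlib.Analysis.Normed.Operator.Bilinear
import Mathlib.Topology.Algebra.Module.FiniteDimension
import Mathlib.Order.ConditionallyCompleteLattice.Indexed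

/-!
# THE HARD STEP PRESERVES SMOOTHNESS — WINDOWED: along ANY branch of constrained critical points (`D(σ w) = w`, `DV(σ w)`
# kills `ker D`, `σ` of class `Cⁿ` at `w₀`, `σ w₀ = δ₀` — this lineage's `ConstrainedMinimiserRegular` §1 manufactures it)
# of an action CONVEX ON A CONVEX WINDOW `K ∈ 𝓝 δ₀` only, the WINDOWED hard-constraint value
# `φ_K w = ⨅ {V δ : δ ∈ K, D δ = w}` is `C^{n+1}` at `w₀` with `Dφ_K(w) = DV(σ w) ∘ M` for ANY right inverse `M`
# (row NE7b, node U5c; the `K`-currency of this lineage's `ConstrainedValueWindow` ∕ `…WindowSecondOrder` and of CSTF §6's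
# `{δ // δ ∈ K ∧ D δ = w}`; [folklore] sensitivity analysis on a window)

Cell `pub-balaban`, sub-cell `t4`, spine estimate NE7b (`T4WeightBudget.RelWeightBound`; NOT PRINTED in [Bałaban 1983–89],
NOT PROVED).  Crux-route work under `Spine/NE7b/` by leaf-03 (CRUX team (2), FREEZE (0) crux-prover clause).  NOTHING of
Bałaban's is named, asserted, valued or discharged.  Mathlib only; no `def`; zero `sorry`.

WHY.  The road's actions are convex on a small-field WINDOW, not globally (T-80 ∕ T-92 (N-92-1); this lineage's CVW p377647 →
p378036 and CVWS p378696 type the first- and second-order letters of the windowed value `⨅ δ : {δ // δ ∈ K ∧ D δ = w}, V δ`).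
`ConstrainedMinimiserRegular` (CMR, INTENT-2 of this seat) proves the REGULARITY statement — the branch of constrained
critical points is `Cⁿ`, the value is `C^{n+1}` — for `V` convex on ALL of `E`.  Its §1 (the branch, by the inverse function
theorem) is local and needs no convexity; only the identification «branch = minimiser» and the value function used global
convexity.  This file redoes exactly that part on a window, taking the branch as a DISPLAYED letter (CMR §1's conclusion
verbatim: `σ (Dδ₀) = δ₀`, `ContDiffAt ℝ n σ (Dδ₀)`, eventually `D(σ w) = w ∧ DV(σ w)|_{ker D} = 0`), so that it is Mathlib-only
and composes with CMR by name (`obtain ⟨σ, …⟩ := CMR.exists_contDiffAt_criticalBranch_of_pos …`), no import either way.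

WHAT IS PROVED ([folklore]; Fiacco 1983 §3.2 ∕ Bonnans–Shapiro 2000 §4.7 localised):
* §1 `convexOn_support_of_hasFDerivAt` — `V` convex on `K`, `x, y ∈ K`, `HasFDerivAt V V' x` ⟹ `V x + V′(y − x) ≤ V y`
  (the segment lies in `K`; normed `E`).
* §2 `isMinOn_windowFibre_of_critical` — `V` convex on `K`, `δ ∈ K`, differentiable at `δ`, `DV(δ)` kills `ker D` ⟹ `δ`
  minimises `V` on the windowed fibre `{δ′ ∈ K : D δ′ = D δ}`; `branch_isMinOn_window` (along the branch).
* §3 `iInf_windowFibre_eq_of_isMinOn` — `⨅ δ : {δ // δ ∈ K ∧ D δ = w}, V δ = V (σ w)` where the branch minimises.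
* §4 `hasFDerivAt_constrValue_window_branch` — EVENTUALLY in `w → w₀`: `HasFDerivAt φ_K (DV(σ w) ∘ M) w`, `M` ANY right
  inverse of `D` (chain rule along `σ`; the directions `Dσ(w)h − Mh` lie in `ker D` — `HasFDerivAt.unique` on `D ∘ σ =ᶠ id` —
  and are killed by criticality; inlined, CMR §3's computation).
* §5 **`contDiffAt_constrValue_window`** — THE END: `K` convex with `K ∈ 𝓝 δ₀`, `V` convex ON `K` and `C^{n+1}` at `δ₀`
  (`1 ≤ n`), a right inverse `M` of `D`, and the branch letter ⟹ `ContDiffAt ℝ (n + 1) (fun w => ⨅ δ : {δ // δ ∈ K ∧ D δ = w},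
  V δ.1) (D δ₀)` — one order MORE than the branch (`Dφ_K = (DV ∘ σ) ∘ M` is `Cⁿ`; `contDiffAt_succ_iff_hasFDerivAt`).
* §6 toy (`example`): `E = F = ℝ`, `D = id`, `σ = id`, `K = univ`: `φ_K = V`.

NOT HERE (honest): the branch itself (CMR §1: non-degeneracy of `D²V(δ₀)` on `ker D`, finite dimension); uniqueness of the
windowed minimiser (CVW §6 `eq_of_isMinOn_window`); the Hessian identity (CVWS ∕ CVH, Peano side); nonlinear constraints;
which `(V, K, D)` are Bałaban's ((A3) ∕ (A1c), NC-NE7b-α UNRULED).  BY-NAME EFFECT ON THE WALL: NONE.  NE7b NOT PRINTED ∕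
NOT PROVED; spine PROVED 0∕9; rung (B)+1 on a FINITE torus — NOT infinite volume, NOT the mass gap, NOT Clay.  HONEST
DEPENDENCY: continuum YM on T⁴ ⇐ BetaPertH ∧ nine spine estimates (0/9 proved); BetaPertH ⇐ (D1) ∧ (D4) ∧ CAP+tail;
G-an2-4 gates asym, D1 and NE2∕3∕4.
-/

set_option autoImplicit false

noncomputable section

namespace Summit.QuantumFields.BalabanUV.T4Continuum.NE7b.ConstrainedMinimiserRegularWindow

open Set Filter Topology Function

variable {E F : Type*} [NormedAddCommGroup E] [NormedSpace ℝ E] [NormedAddCommGroup F] [NormedSpace ℝ F]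

/-! ## §1. The differential of a function convex on a window supports it on the window -/

/-- `V` convex on `K`, `x, y ∈ K`, `HasFDerivAt V V' x` ⟹ `V x + V′ (y − x) ≤ V y` (normed `E`; the slope of `V` along the
segment `[x, y] ⊆ K` is at most `V y − V x` and tends to `V′(y − x)`). [folklore] -/
theorem convexOn_support_of_hasFDerivAt {V : E → ℝ} {K : Set E} (hVc : ConvexOn ℝ K V) {x y : E} (hx : x ∈ K)
    (hy : y ∈ K) {V' : E →L[ℝ] ℝ} (hd : HasFDerivAt V V' x) : V x + V' (y - x) ≤ V y := by
  set g : ℝ → ℝ := fun t => V (x + t • (y - x)) with hg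
  have hgd : HasDerivAt g (V' (y - x)) 0 := by
    have hline : HasDerivAt (fun t : ℝ => x + t • (y - x)) (y - x) 0 := by
      simpa using ((hasDerivAt_id (0 : ℝ)).smul_const (y - x)).const_add x
    have hd' : HasFDerivAt V V' (x + (0 : ℝ) • (y - x)) := by simpa using hd
    exact hd'.comp_hasDerivAt 0 hline
  have hslope : ∀ t ∈ Ioo (0 : ℝ) 1, t⁻¹ • (g (0 + t) - g 0) ≤ V y - V x := by
    intro t ht
    have hconv := hVc.2 hx hy (by linarith [ht.2] : 0 ≤ 1 - t) ht.1.le (by ring)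
    have hpt : (1 - t) • x + t • y = x + t • (y - x) := by
      simp only [sub_smul, one_smul, smul_sub]; abel
    rw [hpt] at hconv
    have hg0 : g 0 = V x := by simp [hg]
    have hgt : g (0 + t) = V (x + t • (y - x)) := by simp [hg]
    rw [hg0, hgt, smul_eq_mul, ← div_eq_inv_mul, div_le_iff₀ ht.1]
    simp only [smul_eq_mul] at hconv
    nlinarith [hconv, ht.1]
  have htend : Tendsto (fun t => t⁻¹ • (g (0 + t) - g 0)) (𝓝[>] 0) (𝓝 (V' (y - x))) :=
    hgd.tendsto_slope_zero_right
  have hle : V' (y - x) ≤ V y - V x :=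
    le_of_tendsto htend (by filter_upwards [Ioo_mem_nhdsGT zero_lt_one] with t ht using hslope t ht)
  linarith

/-! ## §2. Convex on the window + fibre-critical ⟹ minimal on the windowed fibre -/

/-- **WINDOWED: CONVEX + FIBRE-CRITICAL ⟹ FIBRE-MINIMAL ON THE WINDOW.**  `V` convex on `K`, `δ ∈ K`, `V` differentiable at
`δ` with `DV(δ)` killing `ker D` ⟹ `δ` minimises `V` on `{δ′ ∈ K : D δ′ = D δ}`. [folklore] -/
theorem isMinOn_windowFibre_of_critical {V : E → ℝ} {K : Set E} (hVc : ConvexOn ℝ K V) (D : E →L[ℝ] F) {δ : E}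
    (hδ : δ ∈ K) (hd : DifferentiableAt ℝ V δ) (hcrit : ∀ k ∈ D.ker, fderiv ℝ V δ k = 0) :
    IsMinOn V {δ' | δ' ∈ K ∧ D δ' = D δ} δ := by
  intro δ' hδ'
  have hk : δ' - δ ∈ D.ker := by
    rw [LinearMap.mem_ker, ContinuousLinearMap.coe_coe, map_sub, sub_eq_zero]; exact hδ'.2
  have h := convexOn_support_of_hasFDerivAt hVc hδ hδ'.1 hd.hasFDerivAt
  rw [hcrit _ hk, add_zero] at h
  exact h

/-- Along a branch: wherever `σ w ∈ K`, `D(σ w) = w`, `V` differentiable at `σ w` and `σ w` fibre-critical, `σ w` minimises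
`V` on the windowed fibre over `w`. [folklore] -/
theorem branch_isMinOn_window {V : E → ℝ} {K : Set E} (hVc : ConvexOn ℝ K V) (D : E →L[ℝ] F) {σ : F → E} {w : F}
    (hK : σ w ∈ K) (hDσ : D (σ w) = w) (hd : DifferentiableAt ℝ V (σ w))
    (hcrit : ∀ k ∈ D.ker, fderiv ℝ V (σ w) k = 0) : IsMinOn V {δ | δ ∈ K ∧ D δ = w} (σ w) := by
  have h := isMinOn_windowFibre_of_critical hVc D hK hd hcrit
  rwa [hDσ] at h

/-! ## §3. The windowed value along the branch -/

/-- `⨅ δ : {δ // δ ∈ K ∧ D δ = w}, V δ = V (σ w)` where the branch lies in the window and minimises there. [folklore] -/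
theorem iInf_windowFibre_eq_of_isMinOn {V : E → ℝ} {K : Set E} (D : E →L[ℝ] F) {σ : F → E} {w : F} (hK : σ w ∈ K)
    (hDσ : D (σ w) = w) (hmin : IsMinOn V {δ | δ ∈ K ∧ D δ = w} (σ w)) :
    (⨅ δ : {δ // δ ∈ K ∧ D δ = w}, V δ.1) = V (σ w) := by
  haveI : Nonempty {δ // δ ∈ K ∧ D δ = w} := ⟨⟨σ w, hK, hDσ⟩⟩
  have hle : ∀ δ : {δ // δ ∈ K ∧ D δ = w}, V (σ w) ≤ V δ.1 := fun δ => hmin δ.2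
  have hbdd : BddBelow (range fun δ : {δ // δ ∈ K ∧ D δ = w} => V δ.1) :=
    ⟨V (σ w), by rintro _ ⟨δ, rfl⟩; exact hle δ⟩
  exact le_antisymm (ciInf_le hbdd ⟨σ w, hK, hDσ⟩) (le_ciInf hle)

/-! ## §4. The envelope derivative of the windowed value near `w₀` -/

/-- **EVENTUALLY `Dφ_K(w) = DV(σ w) ∘ M`.**  `V` convex on `K`; a map `σ` with, eventually in `w → w₀`: `σ w ∈ K`,
`D(σ w) = w`, `σ w` fibre-critical, `σ` differentiable at `w`, `V` differentiable at `σ w`; `M` ANY right inverse of `D`.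
Then eventually `HasFDerivAt (fun w => ⨅ δ : {δ // δ ∈ K ∧ D δ = w}, V δ) ((fderiv ℝ V (σ w)).comp M) w`. [folklore] -/
theorem hasFDerivAt_constrValue_window_branch {V : E → ℝ} {K : Set E} (hVc : ConvexOn ℝ K V) {D : E →L[ℝ] F}
    {M : F →L[ℝ] E} (hM : ∀ w, D (M w) = w) {σ : F → E} {w₀ : F} (hKσ : ∀ᶠ w in 𝓝 w₀, σ w ∈ K)
    (hbr : ∀ᶠ w in 𝓝 w₀, D (σ w) = w ∧ ∀ k ∈ D.ker, fderiv ℝ V (σ w) k = 0)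
    (hσd : ∀ᶠ w in 𝓝 w₀, DifferentiableAt ℝ σ w) (hVd : ∀ᶠ w in 𝓝 w₀, DifferentiableAt ℝ V (σ w)) :
    ∀ᶠ w in 𝓝 w₀, HasFDerivAt (fun w => ⨅ δ : {δ // δ ∈ K ∧ D δ = w}, V δ.1) ((fderiv ℝ V (σ w)).comp M) w := by
  have hev : ∀ᶠ w in 𝓝 w₀, (⨅ δ : {δ // δ ∈ K ∧ D δ = w}, V δ.1) = V (σ w) := by
    filter_upwards [hKσ, hbr, hVd] with w hKw hw hVw
    exact iInf_windowFibre_eq_of_isMinOn D hKw hw.1 (branch_isMinOn_window hVc D hKw hw.1 hVw hw.2)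
  filter_upwards [eventually_eventually_nhds.mpr hbr, eventually_eventually_nhds.mpr hev, hbr, hσd, hVd]
    with w hbrw hevw hw hσw hVw
  -- chain rule along `σ`, and `D ∘ Dσ(w) = id` (CMR §3's computation, inlined)
  have hchain : HasFDerivAt (V ∘ σ) ((fderiv ℝ V (σ w)).comp (fderiv ℝ σ w)) w :=
    hVw.hasFDerivAt.comp w hσw.hasFDerivAt
  have hDs : HasFDerivAt (fun w' => D (σ w')) (D.comp (fderiv ℝ σ w)) w := D.hasFDerivAt.comp w hσw.hasFDerivAt
  have hid : HasFDerivAt (fun w' => D (σ w')) (ContinuousLinearMap.id ℝ F) w :=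
    (hasFDerivAt_id w).congr_of_eventuallyEq (hbrw.mono fun w' hw' => by simp [hw'.1])
  have hDσ' : D.comp (fderiv ℝ σ w) = ContinuousLinearMap.id ℝ F := hDs.unique hid
  have heq : (fderiv ℝ V (σ w)).comp (fderiv ℝ σ w) = (fderiv ℝ V (σ w)).comp M := by
    ext h
    have hk : fderiv ℝ σ w h - M h ∈ D.ker := by
      rw [LinearMap.mem_ker, ContinuousLinearMap.coe_coe, map_sub, hM, sub_eq_zero]
      exact congrArg (fun L : F →L[ℝ] F => L h) hDσ'
    have h0 := hw.2 _ hk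
    rw [map_sub, sub_eq_zero] at h0
    simpa using h0
  have hcomp : HasFDerivAt (V ∘ σ) ((fderiv ℝ V (σ w)).comp M) w := by rw [← heq]; exact hchain
  exact hcomp.congr_of_eventuallyEq (hevw.mono fun w' hw' => by simpa [Function.comp] using hw')

/-! ## §5. The END: the windowed value is `C^{n+1}` at `w₀` -/

/-- **THE WINDOWED HARD-CONSTRAINT VALUE IS `C^{n+1}` ALONG A `Cⁿ` BRANCH.**  `K` with `K ∈ 𝓝 δ₀`, `V` convex ON `K` and
of class `C^{n+1}` at `δ₀` (`1 ≤ n`), `M` a right inverse of `D`, and a branch `σ` — `σ (Dδ₀) = δ₀`, `ContDiffAt ℝ n σ (Dδ₀)`,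
eventually `D(σ w) = w ∧ DV(σ w)|_{ker D} = 0` (this lineage's `ConstrainedMinimiserRegular.exists_contDiffAt_criticalBranch`
delivers exactly this letter at a non-degenerate fibre-critical `δ₀`).  Then `w ↦ ⨅ δ : {δ // δ ∈ K ∧ D δ = w}, V δ` is
`C^{n+1}` at `Dδ₀`. [folklore] -/
theorem contDiffAt_constrValue_window {V : E → ℝ} {K : Set E} (hVc : ConvexOn ℝ K V) {δ₀ : E} (hK : K ∈ 𝓝 δ₀)
    {D : E →L[ℝ] F} {M : F →L[ℝ] E} (hM : ∀ w, D (M w) = w) {n : ℕ} (hn : 1 ≤ n)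
    (hV : ContDiffAt ℝ (n + 1) V δ₀) {σ : F → E} (hσ0 : σ (D δ₀) = δ₀) (hσcd : ContDiffAt ℝ n σ (D δ₀))
    (hbr : ∀ᶠ w in 𝓝 (D δ₀), D (σ w) = w ∧ ∀ k ∈ D.ker, fderiv ℝ V (σ w) k = 0) :
    ContDiffAt ℝ (n + 1) (fun w => ⨅ δ : {δ // δ ∈ K ∧ D δ = w}, V δ.1) (D δ₀) := by
  have hn0 : (n : WithTop ℕ∞) ≠ 0 := by exact_mod_cast (Nat.one_le_iff_ne_zero.mp hn)
  have hn1 : ((n : WithTop ℕ∞) + 1) ≠ 0 := by exact_mod_cast Nat.succ_ne_zero n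
  have hn1' : ((n : WithTop ℕ∞) + 1) ≠ ((⊤ : ℕ∞) : WithTop ℕ∞) := by exact_mod_cast ENat.coe_ne_top (n + 1)
  have hn' : (n : WithTop ℕ∞) ≠ ((⊤ : ℕ∞) : WithTop ℕ∞) := by exact_mod_cast ENat.coe_ne_top n
  have hσc : ContinuousAt σ (D δ₀) := hσcd.continuousAt
  -- the branch stays in the window, is differentiable, and `V` is differentiable along it
  have hKσ : ∀ᶠ w in 𝓝 (D δ₀), σ w ∈ K := by
    have hK' : K ∈ 𝓝 (σ (D δ₀)) := by rw [hσ0]; exact hK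
    exact hσc.preimage_mem_nhds hK'
  have hσd : ∀ᶠ w in 𝓝 (D δ₀), DifferentiableAt ℝ σ w :=
    (hσcd.eventually hn').mono fun w hw => hw.differentiableAt hn0
  have hdV : ContDiffAt ℝ n (fderiv ℝ V) δ₀ := hV.fderiv_right (by norm_cast)
  have hVd : ∀ᶠ w in 𝓝 (D δ₀), DifferentiableAt ℝ V (σ w) := by
    have h1 : ∀ᶠ δ in 𝓝 δ₀, DifferentiableAt ℝ V δ :=
      (hV.eventually hn1').mono fun δ hδ => hδ.differentiableAt hn1
    rw [← hσ0] at h1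
    exact hσc.eventually h1
  have hderiv := hasFDerivAt_constrValue_window_branch hVc hM hKσ hbr hσd hVd
  -- one more derivative
  rw [show ((n : WithTop ℕ∞) + 1) = ((n + 1 : ℕ) : WithTop ℕ∞) by norm_cast] at *
  rw [show ((n + 1 : ℕ) : WithTop ℕ∞) = (n : WithTop ℕ∞) + 1 by norm_cast, contDiffAt_succ_iff_hasFDerivAt]
  refine ⟨fun w => (fderiv ℝ V (σ w)).comp M, ?_, ?_⟩
  · obtain ⟨u, hu, hu'⟩ := eventually_iff_exists_mem.mp hderiv
    exact ⟨u, hu, hu'⟩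
  · have hg : ContDiffAt ℝ n (fun w => fderiv ℝ V (σ w)) (D δ₀) := by
      have h1 : ContDiffAt ℝ n (fderiv ℝ V) (σ (D δ₀)) := by rw [hσ0]; exact hdV
      exact h1.comp (D δ₀) hσcd
    exact ((ContinuousLinearMap.compL ℝ F E ℝ).flip M).contDiff.contDiffAt.comp (D δ₀) hg

/-! ## §6. Toy -/

/-- Toy: `E = F = ℝ`, `D = M = id`, branch `σ = id`, window `K = univ`: the windowed value is `V` itself and the END
returns `V`'s own class. [folklore] -/
example {V : ℝ → ℝ} (hVc : ConvexOn ℝ univ V) {x : ℝ} {n : ℕ} (hn : 1 ≤ n) (hV : ContDiffAt ℝ (n + 1) V x) :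
    ContDiffAt ℝ (n + 1)
      (fun w => ⨅ δ : {δ // δ ∈ (univ : Set ℝ) ∧ (ContinuousLinearMap.id ℝ ℝ) δ = w}, V δ.1)
      ((ContinuousLinearMap.id ℝ ℝ) x) := by
  refine contDiffAt_constrValue_window hVc univ_mem (M := ContinuousLinearMap.id ℝ ℝ) (fun w => rfl) hn hV
    (σ := id) rfl contDiffAt_id (Filter.Eventually.of_forall fun w => ⟨rfl, ?_⟩)
  intro k hk
  have hk0 : k = 0 := by simpa using hk
  simp [hk0]

end Summit.QuantumFields.BalabanUV.T4Continuum.NE7b.ConstrainedMinimiserRegularWindow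

end
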